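import Literature.MathematicalPhysics.QuantumLattice.LatticeTori
import HarnessLib

/-!
# The Néel staggering sign flips along nearest-neighbour steps

Topic `MathematicalPhysics/QuantumLattice`; sibling proof file of
`Literature/MathematicalPhysics/QuantumLattice/LatticeTori.lean` (next to `LatticeToriProofs.lean`,
which discharges the torus-metric facts and carries heavier analysis imports). No statement is
introduced or changed; this file **discharges the named fact** `latticeStagger_add_single` of
`LatticeTori`:

* `latticeStagger_add_single_holds : latticeStagger_add_single` — for the Néel sign
  `ε x = (-1)^{Σⱼ |xⱼ|}` on `ℤ^d` (`latticeStagger`), `ε (x + eᵢ) = -ε x` for every site `x` and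
  coordinate direction `i`; usable form `latticeStagger_add_single'`.

The proof is the parity count: `|xᵢ + 1|` and `|xᵢ|` have opposite parities and the other
coordinates do not change.

## References

* F. J. Dyson, E. H. Lieb, B. Simon, *Phase transitions in quantum spin systems with isotropic and
  nonisotropic interactions*, J. Stat. Phys. **18** (1978) 335–383, §6, p. 365: the sublattice
  symmetry `S_α ↦ (-1)^{|α|} S_α`, `|α| = α₁ + ⋯ + α_ν`, exchanging the nearest-neighbour ferro- and
  antiferromagnet on the simple cubic lattice (our exponent `Σⱼ |αⱼ|` has the same parity as
  `Σⱼ αⱼ`).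
-/

open Finset

namespace Literature.MathematicalPhysics.QuantumLattice

open Literature.Probability.LatticeModels

variable {d : ℕ}

/-- Discharge of `latticeStagger_add_single`: moving to a nearest neighbour `x ↦ x + eᵢ` flips the
Néel sign `(-1)^{Σⱼ |xⱼ|}`, because `|xᵢ + 1|` and `|xᵢ|` have opposite parities while the other
coordinates are unchanged. This is the sublattice symmetry `S_α ↦ (-1)^{|α|} S_α`,
`|α| = α₁ + ⋯ + α_ν`, relating the ferro- and antiferromagnet in Dyson–Lieb–Simon (1978), §6,
p. 365 (the exponent `Σⱼ |αⱼ|` used by `latticeStagger` has the same parity as `Σⱼ αⱼ`).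
[cite: DysonLiebSimon1978, §6 p. 365] -/
theorem latticeStagger_add_single_holds : latticeStagger_add_single (d := d) := by
  intro x i
  simp only [latticeStagger_apply]
  have hx : ∑ j, (x j).natAbs = (x i).natAbs + ∑ j ∈ Finset.univ.erase i, (x j).natAbs :=
    (Finset.add_sum_erase _ _ (Finset.mem_univ i)).symm
  have hx' : ∑ j, ((x + Pi.single i 1 : Site d) j).natAbs
      = (x i + 1).natAbs + ∑ j ∈ Finset.univ.erase i, (x j).natAbs := by
    rw [← Finset.add_sum_erase _ _ (Finset.mem_univ i)]
    congr 1
    · simp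
    · refine Finset.sum_congr rfl fun j hj => ?_
      rw [Finset.mem_erase] at hj
      simp [Pi.single_eq_of_ne hj.1]
  rw [hx, hx', pow_add, pow_add, ← neg_mul]
  congr 1
  rcases Int.even_or_odd (x i) with h | h
  · rw [Even.neg_one_pow (Int.natAbs_even.mpr h), Odd.neg_one_pow (Int.natAbs_odd.mpr h.add_one)]
  · rw [Odd.neg_one_pow (Int.natAbs_odd.mpr h), Even.neg_one_pow (Int.natAbs_even.mpr h.add_one),
      neg_neg]

/-- Usable form of `latticeStagger_add_single_holds`: `ε (x + eᵢ) = -ε x` for the Néel sign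
`ε = latticeStagger`. (Dyson–Lieb–Simon 1978, §6, p. 365.) [cite: DysonLiebSimon1978, §6 p. 365] -/
theorem latticeStagger_add_single' (x : Site d) (i : Fin d) :
    latticeStagger (x + Pi.single i 1) = -latticeStagger x :=
  latticeStagger_add_single_holds x i

end Literature.MathematicalPhysics.QuantumLattice
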